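import Summits.MatrixMultiplication.MatrixMultiplication.Theorems.SaturationLadderFrameShadows
import Literature.Computability.AlgebraicComplexity.MatrixMultiplicationExponent
import HarnessLib

/-!
# The frame lifts at level one and squares to `⟨2,2,2⟩`
# (route `SaturationLadder`, item stmt-MatrixMultiplication-25909 `SubexpSaturation`; cell `decomp-mm`, lens 1, gen 34)

PROVED, 0 sorry; no definitions, no instances, no notation, no named facts; route-free (imports the
gen-33 kernel `SaturationLadderFrameShadows` for `frameTensor`, `Literature` and Mathlib only).

Two facts about the moment-curve frames `P_{a,m}(λ) = Σ_z e_z ⊗ (λ_z^k)_{k<a} ⊗ e_z` of the lineage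
(gen 32–33; `frameTensor`), answering the cell's U1-lift question at the two lowest levels:

* §1 **Level one — node collision.** For every field, every `m`, every node vector `λ` with pairwise
  distinct entries and every `z₀ < m`, the frame `P_{2,m}(λ)` DEGENERATES (order `1`, explicit `3`
  polynomial matrices) to the double-node frame `P_{2,m}(δ_{z₀})` (`δ_{z₀}(z) = [z = z₀]`), i.e. to the
  direct sum `⟨1,1,m−1⟩ ⊕ ⟨1⟩` (all nodes `z ≠ z₀` collide to the multiplier vector `(1,0)`, the node
  `z₀` keeps `(1,1)`): `frameTensor_degeneratesTo_frameTensor_indicator`.  By hand (memo g34 §1, not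
  typed: the tree has no quantum functionals) this target is NOT a degeneration of the tight shadow
  `N_{2,m}` — `F^θ(⟨1,1,m−1⟩ ⊕ ⟨1⟩) = (m−1)^{1−θ₂} + 1 > F^θ(N_{2,m})` for small `θ₂ > 0` (both
  sides equal `m` on the face `θ₂ = 0`; compare one-sided `θ₂`-derivatives of `log F`:
  `−(m−1) log(m−1) / m` against `−log m`), and at `(a,m) = (2,3)`, uniform `θ`,
  `2^{2/3} + 1 = 2.5874 > 2.5522 = F^{(1/3,1/3,1/3)}(N_{2,3})` — so the frame's spectral excess over
  its shadow materialises as matrix-multiplication-type structure already at Kronecker level `N = 1`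
  (the critic's U1-lift test, gen 33), albeit value-trivially (outer-product blocks).
* §2 **Level two — a genuine product.** `⟨2,2,2⟩` is a RESTRICTION of the Kronecker square
  `P_{2,3}(0,1,−1) ⊠ P_{2,3}(0,1,−1)` (format `9 × 4 × 9`): an explicit rational `9`-term bilinear
  algorithm for `2 × 2` matrix products whose nine multiplier-leg linear forms are the rank-one forms
  `X ↦ w_{z₁}ᵀ X w_{z₂}`, `w = (e₁, −2e₂, 2(e₁+e₂))` (the images `g u_z` of the nodes
  `u_z = (1,0),(1,1),(1,−1)` under the leg change `g = (1 −1; 0 −2)`):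
  `frameTensor_sq_restrictsTo_matMulTensor_222` (stated under `CharZero`; the certificate has
  denominators dividing `120`).  For `m = 3` all frames with pairwise distinct nodes are isomorphic
  (`PGL₂` is `3`-transitive on `P¹`; rescale the rows), so the choice `λ = (0,1,−1)` is immaterial; with
  `TensorRestrictsTo.algDegeneratesTo` and the gen-33 sandwich this gives `⟨2,2,2⟩ ⊴ P_{2,3}^{⊠2}`, a
  genuinely multiplicative block (all three dimensions `≥ 2`) inside a frame power, which no direct sum
  of the level-one blocks `⟨1,1,L⟩` contains (memo g34 §2: by hand, `⟨2,2,2⟩` is NOT a restriction of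
  the shadow square `N_{2,3}^{⊠2}` numerically, and `T ≤ P_{2,3}^{⊠2}` iff `T` has a `9`-term
  decomposition whose multiplier-leg vectors form a `3 × 3` "addition table" `p_z ⊗ p_{z'}`,
  `p₃ ∝ p₁ + p₂`).

References: [BurgisserClausenShokrollahi1997] ((14.19), (15.19)–(15.20), Ex. 15.9), [Blaser2013] (§5, the
tensor `⟨k,m,n⟩`), [ChristandlVranaZuiddam2023] (§1.1 Kronecker products; the by-hand spectral half of §1),
[Strassen1988].
-/

set_option linter.dupNamespace false

noncomputable section

open scoped BigOperators Polynomial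

namespace Summit.MatrixMultiplication.MatrixMultiplication.Theorems.SaturationLadderFrameLift

open Literature.Computability.AlgebraicComplexity Polynomial
open Summit.MatrixMultiplication.MatrixMultiplication.Theorems.SaturationLadderFrameShadows

universe u

variable {K : Type u} [Field K]

/-! ## §1 Level one: `P_{2,m}(λ) ⊵ P_{2,m}(δ_{z₀}) = ⟨1,1,m−1⟩ ⊕ ⟨1⟩` (node collision) -/

/-- **Node collision (order-`1` degeneration, every field).**  For pairwise distinct nodes `λ` and any
`z₀`, `P_{2,m}(λ) ⊵₁ P_{2,m}(δ_{z₀})` with the polynomial matrices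
`A = diag((λ_{z₀} − λ_z)⁻¹ (z ≠ z₀), 1 (z = z₀))`, `B = (λ_{z₀} + ε, −1; ε, 0)` (rows: target label
`k'`, columns: source power `k`), `C = diag(ε (y ≠ z₀), 1 (y = z₀))`: the entry `(z, k', z)` of
`(A ⊗ B ⊗ C)·P` is `ε + ε²(λ_{z₀}−λ_z)⁻¹` / `ε²(λ_{z₀}−λ_z)⁻¹` for `z ≠ z₀` and `ε` / `ε` for
`z = z₀`, whose `ε¹`-coefficients are the entries `δ_{z₀}(z)^{k'}` of the double-node frame.
[cite: BurgisserClausenShokrollahi1997, (15.19)] -/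
theorem isApproxRestriction_frameTensor_indicator {m : ℕ} {lam : Fin m → K}
    (hlam : Function.Injective lam) (z₀ : Fin m) :
    IsApproxRestriction 1 (frameTensor K 2 m lam) (frameTensor K 2 m fun z => if z = z₀ then 1 else 0)
      (fun z' z => if z = z' then (if z' = z₀ then 1 else C (lam z₀ - lam z')⁻¹) else 0)
      (fun k' k => if (k' : ℕ) = 0 then (if (k : ℕ) = 0 then C (lam z₀) + X else C (-1))
        else (if (k : ℕ) = 0 then X else 0))
      (fun y' y => if y = y' then (if y' = z₀ then 1 else X) else 0) := by
  classical
  intro z' k' y' j hj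
  -- collapse the sums over `z` (forced `z = z'`) and `y` (forced `y = y'`)
  have hsum : (∑ z : Fin m, ∑ k : Fin 2, ∑ y : Fin m,
      (if z = z' then (if z' = z₀ then (1 : K[X]) else C (lam z₀ - lam z')⁻¹) else 0) *
      (if (k' : ℕ) = 0 then (if (k : ℕ) = 0 then C (lam z₀) + X else C (-1))
        else (if (k : ℕ) = 0 then X else 0)) *
      (if y = y' then (if y' = z₀ then (1 : K[X]) else X) else 0) * C (frameTensor K 2 m lam z k y)) =
      ∑ k : Fin 2, (if z' = z₀ then (1 : K[X]) else C (lam z₀ - lam z')⁻¹) *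
      (if (k' : ℕ) = 0 then (if (k : ℕ) = 0 then C (lam z₀) + X else C (-1))
        else (if (k : ℕ) = 0 then X else 0)) *
      ((if y' = z₀ then (1 : K[X]) else X) * C (if y' = z' then lam z' ^ (k : ℕ) else 0)) := by
    rw [Finset.sum_eq_single z' (fun z _ hz => by simp [hz]) (fun h => absurd (Finset.mem_univ _) h)]
    refine Finset.sum_congr rfl fun k _ => ?_
    rw [Finset.sum_eq_single y' (fun y _ hy => by simp [hy]) (fun h => absurd (Finset.mem_univ _) h)]
    simp only [if_true, frameTensor_apply, mul_assoc]
  rw [hsum, Fin.sum_univ_two]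
  by_cases hyz : y' = z'
  · subst hyz
    by_cases hz0 : y' = z₀
    · -- the surviving node `z₀`: entries `X` (label 0) and `X` (label 1)
      subst hz0
      interval_cases j <;> fin_cases k' <;> simp [coeff_X]
    · -- a collided node `z ≠ z₀`: entries `X + (λ_{z₀}−λ_z)⁻¹ X²` (label 0) and `(λ_{z₀}−λ_z)⁻¹ X²`
      have hne : lam z₀ - lam y' ≠ 0 := sub_ne_zero.mpr fun h => hz0 (hlam h).symm
      have hz0' : ¬ (y' = z₀) := hz0
      interval_cases j <;> fin_cases k' <;>
        simp [coeff_mul, Finset.Nat.antidiagonal_succ, coeff_C, coeff_X, hz0']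
      -- the one non-trivial scalar identity: `(λ_{z₀}−λ_z)⁻¹ λ_{z₀} − (λ_{z₀}−λ_z)⁻¹ λ_z = 1`
      all_goals (field_simp; ring)
  · -- off-diagonal output positions vanish
    have hyz' : ¬ (y' = z') := hyz
    simp [hyz']

/-- **`P_{2,m}(λ) ⊵ P_{2,m}(δ_{z₀}) = ⟨1,1,m−1⟩ ⊕ ⟨1⟩`** (pairwise distinct nodes; every field, every `m`,
every `z₀`): the frame's nodes `z ≠ z₀` collide.  The target is the direct sum of the `1 × 1 × (m−1)`
matrix product (multiplier vector `(1,0)` on the rows `z ≠ z₀`) and `⟨1⟩` (vector `(1,1)` on the row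
`z₀`); by hand it is `F^θ`-separated from the tight shadow `N_{2,m}` near `θ₂ = 0` (memo g34 §1).
[cite: BurgisserClausenShokrollahi1997, (15.19)] -/
theorem frameTensor_degeneratesTo_frameTensor_indicator {m : ℕ} {lam : Fin m → K}
    (hlam : Function.Injective lam) (z₀ : Fin m) :
    AlgDegeneratesTo (frameTensor K 2 m lam) (frameTensor K 2 m fun z => if z = z₀ then 1 else 0) :=
  ⟨1, _, _, _, isApproxRestriction_frameTensor_indicator hlam z₀⟩

/-! ## §2 Level two: `⟨2,2,2⟩ ≤ P_{2,3}(0,1,−1)^{⊠2}` by an explicit rational certificate -/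

/-- The three nodes `λ = (0, 1, −1)`, i.e. multiplier vectors `(1,0), (1,1), (1,−1)`. [folklore] -/
theorem injective_nodes3 [CharZero K] : Function.Injective (![0, 1, -1] : Fin 3 → K) := by
  intro i j h
  fin_cases i <;> fin_cases j <;> first | rfl | (exfalso; revert h; norm_num)

/-- Collapsing the restriction sum against a Kronecker square of frames: only `c = a` survives, and the
frame square contributes `λ_{a₁}^{b₁} λ_{a₂}^{b₂}`. [folklore] -/
theorem sum_restrict_frameTensor_sq {α β γ : Type*} {a m : ℕ} (lam : Fin m → K)
    (A : α → Fin m × Fin m → K) (B : β → Fin a × Fin a → K) (Cm : γ → Fin m × Fin m → K)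
    (a' : α) (b' : β) (c' : γ) :
    (∑ x : Fin m × Fin m, ∑ b : Fin a × Fin a, ∑ c : Fin m × Fin m, A a' x * B b' b * Cm c' c *
      kroneckerTensor (frameTensor K a m lam) (frameTensor K a m lam) x b c) =
    ∑ x : Fin m × Fin m, ∑ b : Fin a × Fin a,
      A a' x * B b' b * Cm c' x * (lam x.1 ^ (b.1 : ℕ) * lam x.2 ^ (b.2 : ℕ)) := by
  classical
  refine Finset.sum_congr rfl fun x _ => Finset.sum_congr rfl fun b _ => ?_
  rw [Finset.sum_eq_single x (fun c _ hc => ?_) (fun h => absurd (Finset.mem_univ _) h)]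
  · simp [kroneckerTensor_apply, frameTensor_apply]
  · have : c.1 ≠ x.1 ∨ c.2 ≠ x.2 := by
      by_contra h
      simp only [not_or, not_not] at h
      exact hc (Prod.ext h.1 h.2)
    rcases this with h | h <;> simp [kroneckerTensor_apply, frameTensor_apply, h]

/-- Factorisation of the multiplier-leg sum for a rank-one (Kronecker) multiplier matrix. [folklore] -/
theorem sum_prod_rankOne {a : ℕ} (g₁ g₂ : Fin a → K) (x₁ x₂ : K) :
    (∑ b : Fin a × Fin a, g₁ b.1 * g₂ b.2 * (x₁ ^ (b.1 : ℕ) * x₂ ^ (b.2 : ℕ))) =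
    (∑ k : Fin a, g₁ k * x₁ ^ (k : ℕ)) * (∑ k : Fin a, g₂ k * x₂ ^ (k : ℕ)) := by
  rw [Fintype.sum_prod_type, Finset.sum_mul_sum]
  exact Finset.sum_congr rfl fun i _ => Finset.sum_congr rfl fun j _ => by ring

set_option maxHeartbeats 1600000 in
/-- **`⟨2,2,2⟩` is a restriction of `P_{2,3}(0,1,−1)^{⊠2}`** (stated in characteristic `0`; the certificate
is rational with denominators dividing `120`): with `t = P ⊠ P` on
`(Fin 3 × Fin 3) × (Fin 2 × Fin 2) × (Fin 3 × Fin 3)`, `P = P_{2,3}(0,1,−1)` (multiplier vectors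
`u_z = (1,0), (1,1), (1,−1)`), and `s = ⟨2,2,2⟩` in the tree's convention
(`s (κ,ν) (κ',μ) (μ',ν') = [κ=κ' ∧ μ=μ' ∧ ν=ν']`, [Blaser2013] §5), the matrices `A₀`, `B₀ = g ⊗ g`, `C₀`
below satisfy `s = (A₀ ⊗ B₀ ⊗ C₀)·t`.  Since `g u_z = w_z` with `w = (e₁, −2e₂, 2(e₁+e₂))`
(`g = (1 −1; 0 −2)`), the nine product terms have the rank-one multiplier-leg forms
`X ↦ w_{z₁}ᵀ X w_{z₂}` — an "addition-table" `9`-term bilinear algorithm for `2 × 2` matrix products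
(`w₃ = 2w₁ − w₂`).  Found by alternating least squares and exact rational rounding (memo g34 §2);
verified here entrywise (`64` entries, `9` terms each) by `simp`/`norm_num`.
[cite: Blaser2013, §5 (the tensor ⟨k,m,n⟩)] -/
theorem frameTensor_sq_restrictsTo_matMulTensor_222 [CharZero K] :
    TensorRestrictsTo
      (kroneckerTensor (frameTensor K 2 3 ![0, 1, -1]) (frameTensor K 2 3 ![0, 1, -1]))
      (matMulTensor K 2 2 2) := by
  classical
  let aT : Fin 2 → Fin 2 → Fin 3 → Fin 3 → K := ![![![![(1 : K), (0 : K), ((-1 : K) / 4)], ![(0 : K), (0 : K), (0 : K)], ![(0 : K), (0 : K), (0 : K)]], ![![((2 : K) / 3), ((-1 : K) / 6), ((-1 : K) / 6)], ![((-1 : K) / 6), (0 : K), ((-1 : K) / 12)], ![((-1 : K) / 2), (0 : K), ((1 : K) / 6)]]], ![![![((-16 : K) / 15), ((1 : K) / 15), ((4 : K) / 15)], ![(0 : K), ((-1 : K) / 20), ((1 : K) / 120)], ![(0 : K), ((-1 : K) / 10), ((-4 : K) / 15)]], ![![((-8 : K) / 15), ((1 : K) / 30), ((2 : K) / 15)],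 ![((1 : K) / 6), ((1 : K) / 10), ((1 : K) / 15)], ![(0 : K), ((-1 : K) / 20), ((-2 : K) / 15)]]]]
  let cT : Fin 2 → Fin 2 → Fin 3 → Fin 3 → K := ![![![![(1 : K), (2 : K), (0 : K)], ![(0 : K), (1 : K), (2 : K)], ![(0 : K), (-2 : K), (-1 : K)]], ![![(0 : K), (0 : K), (0 : K)], ![(-3 : K), (0 : K), (0 : K)], ![(-1 : K), (0 : K), (0 : K)]]], ![![![(-1 : K), (-2 : K), (-2 : K)], ![(0 : K), (-1 : K), (0 : K)], ![(0 : K), (2 : K), (0 : K)]], ![![(0 : K), (3 : K), (0 : K)], ![(0 : K), (2 : K), (0 : K)], ![(0 : K), (1 : K), (0 : K)]]]]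
  let g : Fin 2 → Fin 2 → K := ![![1, -1], ![0, -2]]
  let W : Fin 2 → Fin 3 → K := ![![1, 0, 2], ![0, -2, 2]]
  let A₀ : Fin 2 × Fin 2 → Fin 3 × Fin 3 → K := fun p x => aT p.1 p.2 x.1 x.2
  let B₀ : Fin 2 × Fin 2 → Fin 2 × Fin 2 → K := fun p b => g p.1 b.1 * g p.2 b.2
  let C₀ : Fin 2 × Fin 2 → Fin 3 × Fin 3 → K := fun p x => cT p.1 p.2 x.1 x.2
  -- node evaluations `w_z = g u_z`: `W k z = Σ_b g k b λ_z^b`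
  have hw : ∀ (k : Fin 2) (z : Fin 3),
      (∑ b : Fin 2, g k b * ((![0, 1, -1] : Fin 3 → K) z) ^ (b : ℕ)) = W k z := by
    intro k z
    fin_cases k <;> fin_cases z <;> norm_num [g, W, Fin.sum_univ_two]
  refine ⟨A₀, B₀, C₀, fun a' b' c' => ?_⟩
  rw [sum_restrict_frameTensor_sq (K := K) ![0, 1, -1] A₀ B₀ C₀ a' b' c']
  -- factor the multiplier-leg sum through the node evaluations
  have hfac : ∀ x : Fin 3 × Fin 3,
      (∑ b : Fin 2 × Fin 2, A₀ a' x * B₀ b' b * C₀ c' x *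
        (((![0, 1, -1] : Fin 3 → K) x.1) ^ (b.1 : ℕ) * ((![0, 1, -1] : Fin 3 → K) x.2) ^ (b.2 : ℕ))) =
      A₀ a' x * C₀ c' x * (W b'.1 x.1 * W b'.2 x.2) := by
    intro x
    rw [← hw b'.1 x.1, ← hw b'.2 x.2, ← sum_prod_rankOne, Finset.mul_sum]
    exact Finset.sum_congr rfl fun b _ => by ring
  rw [Finset.sum_congr rfl fun x _ => hfac x]
  obtain ⟨κ, ν⟩ := a'
  obtain ⟨κ', μ⟩ := b'
  obtain ⟨μ', ν'⟩ := c'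
  simp only [A₀, C₀, Fintype.sum_prod_type, Fin.sum_univ_succ, Fin.sum_univ_zero, matMulTensor]
  fin_cases κ <;> fin_cases ν <;> fin_cases κ' <;> fin_cases μ <;> fin_cases μ' <;> fin_cases ν' <;>
    simp [aT, cT, W] <;> norm_num

end Summit.MatrixMultiplication.MatrixMultiplication.Theorems.SaturationLadderFrameLift
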